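import Literature.MathematicalPhysics.QuantumManyBody.PeriodicBoseGasImpurityTranslation
import Literature.MathematicalPhysics.QuantumManyBody.PeriodicBoseGasFourier
import Literature.MathematicalPhysics.QuantumManyBody.BoseGasFreeDirichletBEC
import Literature.MathematicalPhysics.QuantumManyBody.BoseGasDirichletWall
import Literature.MathematicalPhysics.QuantumManyBody.SwapPurity
import Summits.AtomisticToContinuum.BoseEinsteinCondensation.Theorems.BECThomsonPrinciplePeriodicToDirichletInnerFlatToBEC
import Mathlib.MeasureTheory.Measure.WithDensity

/-!
# Crux `BoundaryTransferWeak` (stmt-AtomisticToContinuum-0827, routes `BECInsertionCorrector` /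
# `BECPeriodicReduction`), line `Sketch` (coupled-bath-relocation): stub `stub_torusTypicality`

Where the torus-BEC hypothesis `A` enters the line: if every `δ`-near-minimiser on the torus of
side `L` has constant-mode occupation `≥ c(n+1)`, then ONE `δ`-near-minimiser `Φ` has a law
`P = |Φ|² 1_{cell^{n+1}} dW` charging with probability `≥ c/16` a measurable event on which the
tagged particle `W 0` lies in the inner cube `C = (L/4, 3L/4)³` and the slice `φ = |Φ(·, Ŵ)|`,
`Ŵ = tail W`, has positive mass on `C` and Bhattacharyya flatness `(∫_C φ)² ≥ (c/16)|C| ∫_C φ²`.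
Proof: near-minimiser `Φ₀` + `A`; sub-cube pigeonhole `n₀ ≤ 8(n+1)L⁻³ ∑_q ∫ (∫_{Q_q} |Φ₀|)²`
(Cauchy–Schwarz, no rigid invariance); rigid translation of the STATE moving the good `Q_q` onto
`C` (a.e.), same energy, `∫_{cellⁿ}(∫_C |Φ|)² = ∫_{cellⁿ}(∫_{Q_q} |Φ₀|)²` by the shift of the
fundamental cell; one-bath disintegration `E_P[1_C(W 0) J²/(|C| m)] ≥ |C|⁻¹ ∫ J² ≥ c/8`
(`J = ∫_C φ`, `m = ∫_C φ²`, the functional is `≤ 1` by Cauchy–Schwarz); reverse Markov. [folklore]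
-/

noncomputable section

namespace Summit.AtomisticToContinuum.BoseEinsteinCondensation.CoupledBaths

open Literature.MathematicalPhysics.QuantumManyBody.BoseGas MeasureTheory Filter
open scoped ENNReal NNReal ComplexConjugate

section Helpers

variable {n : ℕ} {L : ℝ}

/-- `(∑ᵢ aᵢ)² ≤ #s · ∑ᵢ aᵢ²` in `ℝ≥0∞` (Cauchy–Schwarz). [folklore] -/
private theorem ennreal_sq_sum_le {ι : Type*} (s : Finset ι) (a : ι → ℝ≥0∞) :
    (∑ i ∈ s, a i) ^ 2 ≤ (s.card : ℝ≥0∞) * ∑ i ∈ s, a i ^ 2 := by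
  -- adapted from `ennreal_sq_sum_le_card_mul_sum_sq` (Literature/Analysis/FluidPDE)
  by_cases h : ∃ i ∈ s, a i = ⊤
  · obtain ⟨i, hi, htop⟩ := h
    refine le_top.trans_eq (ENNReal.mul_eq_top.2 (Or.inl ⟨?_, ?_⟩)).symm
    · exact_mod_cast (Finset.card_pos.2 ⟨i, hi⟩).ne'
    · exact ENNReal.sum_eq_top.2 ⟨i, hi, by simp [htop]⟩
  · push Not at h
    have e : ∀ i ∈ s, a i = ((a i).toNNReal : ℝ≥0∞) :=
      fun i hi => (ENNReal.coe_toNNReal (h i hi)).symm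
    rw [Finset.sum_congr rfl e, Finset.sum_congr rfl
      (show ∀ i ∈ s, a i ^ 2 = ((a i).toNNReal : ℝ≥0∞) ^ 2 from fun i hi => by rw [← e i hi])]
    exact_mod_cast sq_sum_le_card_mul_sum_sq (s := s) (f := fun i => (a i).toNNReal)

/-- **Reverse Markov**: for measurable `F ≤ 1` on a space of mass `≤ 1`, `∫ F ≥ 2a` forces
`μ{F ≥ a} ≥ a`. [folklore] -/
private theorem le_measure_setOf_le {α : Type*} [MeasurableSpace α] {μ : Measure α}
    (hμ : μ Set.univ ≤ 1) {F : α → ℝ≥0∞} (hF : Measurable F) (hF1 : ∀ x, F x ≤ 1) {a : ℝ≥0∞}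
    (ha : a ≠ ⊤) (h : a + a ≤ ∫⁻ x, F x ∂μ) : a ≤ μ {x | a ≤ F x} := by
  have hS : MeasurableSet {x | a ≤ F x} := measurableSet_le measurable_const hF
  rw [← lintegral_add_compl F hS] at h
  have h1 : ∫⁻ x in {x | a ≤ F x}, F x ∂μ ≤ μ {x | a ≤ F x} :=
    (lintegral_mono fun x => hF1 x).trans_eq (setLIntegral_one _)
  have h2 : ∫⁻ x in {x | a ≤ F x}ᶜ, F x ∂μ ≤ a :=
    (setLIntegral_mono' hS.compl fun x hx => (not_le.mp fun h' => hx h').le).trans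
      ((setLIntegral_const _ _).trans_le
        (mul_le_of_le_one_right' ((measure_mono (Set.subset_univ _)).trans hμ)))
  exact (ENNReal.add_le_add_iff_right ha).mp (h.trans (add_le_add h1 h2))

/-- `j²/V ≤ m · (j²/(V m))` for finite `m` (equality unless `m = 0`, where `j = 0`). [folklore] -/
private theorem sq_div_le_mul_div {j V m : ℝ≥0∞} (hmt : m ≠ ⊤) (hjm : j ^ 2 ≤ V * m) :
    j ^ 2 / V ≤ m * (j ^ 2 / (V * m)) := by
  by_cases hm : m = 0
  · rw [hm, mul_zero, nonpos_iff_eq_zero] at hjm; simp [hjm]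
  · rw [mul_comm V m, ← mul_div_assoc, ENNReal.mul_div_mul_left _ _ hm hmt]

/-- Reading off the good event: `0 < a ≤ 1_C(w) · j²/(V m)` with `j² ≤ V m`, `V, m` finite and
`V ≠ 0` forces `w ∈ C`, `0 < m` and `a V m ≤ j²`. [folklore] -/
private theorem good_of_le {w : Space} {C : Set Space} {a j V m : ℝ≥0∞} (ha : a ≠ 0)
    (hV : V ≠ 0) (hVt : V ≠ ⊤) (hmt : m ≠ ⊤) (hjm : j ^ 2 ≤ V * m)
    (h : a ≤ C.indicator (fun _ => (1 : ℝ≥0∞)) w * (j ^ 2 / (V * m))) :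
    w ∈ C ∧ 0 < m ∧ a * (V * m) ≤ j ^ 2 := by
  by_cases hw : w ∈ C
  · rw [Set.indicator_of_mem hw, one_mul] at h
    have hm : m ≠ 0 := fun hm => by
      rw [hm, mul_zero, nonpos_iff_eq_zero] at hjm
      rw [hjm, ENNReal.zero_div, nonpos_iff_eq_zero] at h
      exact ha h
    exact ⟨hw, pos_iff_ne_zero.mpr hm, (ENNReal.le_div_iff_mul_le (Or.inl (mul_ne_zero hV hm))
      (Or.inl (ENNReal.mul_ne_top hVt hmt))).mp h⟩
  · rw [Set.indicator_of_notMem hw, zero_mul, nonpos_iff_eq_zero] at h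
    exact absurd h ha

/-- Cauchy–Schwarz against `1` on a set: `(∫_C f)² ≤ |C| ∫_C f²`. [folklore] -/
private theorem sq_setLIntegral_le {f : Space → ℝ≥0∞} (hf : Measurable f) (C : Set Space) :
    (∫⁻ y in C, f y) ^ 2 ≤ volume C * ∫⁻ y in C, f y ^ 2 := by
  have h := lintegral_mul_sq_le (volume.restrict C) (f := f) (g := fun _ => 1)
    hf.aemeasurable aemeasurable_const
  rw [mul_comm]
  simpa only [mul_one, one_pow, lintegral_one, Measure.restrict_apply_univ] using h

/-- Near-minimisers of the periodic energy exist at every positive slack: for `L > 0` the trial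
class is inhabited (the free periodic ground-state energy is `0`, not `⊤`). [folklore] -/
private theorem exists_nearMinimiser (v : ℝ → ℝ≥0∞) (N : ℕ) (hL : 0 < L) {δ : ℝ≥0∞}
    (hδ : 0 < δ) :
    ∃ Ψ : PeriodicTrialState N L, periodicEnergy v Ψ ≤ periodicGroundStateEnergy v N L + δ := by
  -- adapted from `exists_nearMinimiser` of …PeriodicToDirichletTorusFloorFromA.lean
  rcases isEmpty_or_nonempty (PeriodicTrialState N L) with h | ⟨⟨Ψ₀⟩⟩
  · have h0 := periodicGroundStateEnergy_zero_eq_zero N hL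
    rw [periodicGroundStateEnergy, iInf_of_empty] at h0
    exact absurd h0 ENNReal.top_ne_zero
  · by_cases htop : periodicGroundStateEnergy v N L = ⊤
    · exact ⟨Ψ₀, by rw [htop, top_add]; exact le_top⟩
    · exact (iInf_lt_iff.mp (ENNReal.lt_add_right htop hδ.ne' : (⨅ Ψ : PeriodicTrialState N L,
        periodicEnergy v Ψ) < periodicGroundStateEnergy v N L + δ)).imp fun Ψ hΨ => hΨ.le

/-- `Y ↦ ∫_Q G(x :: Y) dx` is measurable for measurable `G ≥ 0` (Tonelli). [folklore] -/
private theorem measurable_setLIntegral_vecCons {G : Config (n + 1) → ℝ≥0∞} (hG : Measurable G)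
    (Q : Set Space) : Measurable fun Y : Config n => ∫⁻ x in Q, G (Matrix.vecCons x Y) :=
  (hG.comp (measurable_vecCons.comp measurable_swap)).lintegral_prod_right'

/-- `(y :: Y) - (t, …, t) = (y - t) :: (Y - (t, …, t))`. [folklore] -/
private theorem vecCons_sub_const (y t : Space) (Y : Config n) :
    (Matrix.vecCons y Y - fun _ => t : Config (n + 1)) =
      Matrix.vecCons (y - t) (Y - fun _ => t) := by
  funext i
  refine Fin.cases ?_ (fun j => ?_) i <;> simp

/-- `x :: (Y + e_m ⊗ u) = (x :: Y) + e_{m+1} ⊗ u`. [folklore] -/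
private theorem cons_add_single_succ (x : Space) (Y : Config n) (m : Fin n) (u : Space) :
    (Matrix.vecCons x (Y + Pi.single m u) : Config (n + 1)) =
      Matrix.vecCons x Y + Pi.single m.succ u := by
  -- adapted from …Theorems/BECThomsonPrinciplePeriodicToDirichletTorusLocalCondensation.lean
  funext i
  refine Fin.cases ?_ (fun m' => ?_) i
  · simp [Ne.symm (Fin.succ_ne_zero m)]
  · by_cases h : m' = m
    · subst h; simp
    · simp [h, Fin.succ_inj]

/-- `∫_S g(y - t) dy = ∫_{S - t} g` (translation invariance of Lebesgue measure). [folklore] -/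
private theorem setLIntegral_comp_sub (g : Space → ℝ≥0∞) (t : Space) (S : Set Space) :
    ∫⁻ y in S, g (y - t) = ∫⁻ x in (fun x => x + t) ⁻¹' S, g x := by
  have h := (measurePreserving_add_right volume t).setLIntegral_comp_preimage_emb
    (measurableEmbedding_addRight t) (fun y => g (y - t)) S
  simpa only [add_sub_cancel_right] using h.symm

/-- The shift `t(q)`, `t_k = L/4 - q_k L/2`, carries the sub-cube `Q_q = q L/2 + [0, L/2)³` onto
the inner cube `C = (L/4, 3L/4)³` up to a null set: `C - t(q)` is the interior of `Q_q`.
[folklore] -/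
private theorem preimage_inner_ae_eq_subCell (L : ℝ) (q : SubIdx 2) :
    ((fun x : Space => x + WithLp.toLp 2 fun k => 1 / 4 * L - L / 2 * ((q k : ℕ) : ℝ)) ⁻¹'
      {x : Space | ∀ t, x t ∈ Set.Ioo (1 / 4 * L) (L - 1 / 4 * L)}) =ᵐ[volume]
      subCell (L / 2) q := by
  -- adapted from `boxIoc_ae_eq_cell` (Literature/…/PeriodicBoseGasFourier.lean)
  have h1 : ((fun x : Space => x + WithLp.toLp 2 fun k => 1 / 4 * L - L / 2 * ((q k : ℕ) : ℝ))
      ⁻¹' {x : Space | ∀ t, x t ∈ Set.Ioo (1 / 4 * L) (L - 1 / 4 * L)}) =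
      (@WithLp.ofLp 2 (Fin 3 → ℝ)) ⁻¹' (Set.univ.pi fun k =>
        Set.Ioo (L / 2 * ((q k : ℕ) : ℝ)) (L / 2 * ((q k : ℕ) : ℝ) + L / 2)) := by
    ext x
    simp only [Set.mem_preimage, Set.mem_setOf_eq, PiLp.add_apply, Set.mem_Ioo, Set.mem_univ_pi]
    refine forall_congr' fun k => ?_
    constructor <;> rintro ⟨h1, h2⟩ <;> constructor <;> linarith
  have h2 : subCell (L / 2) q = (@WithLp.ofLp 2 (Fin 3 → ℝ)) ⁻¹' (Set.univ.pi fun k =>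
      Set.Ico (L / 2 * ((q k : ℕ) : ℝ)) (L / 2 * ((q k : ℕ) : ℝ) + L / 2)) := by
    ext x; simp [mem_subCell]
  rw [h1, h2]
  refine (PiLp.volume_preserving_ofLp (Fin 3)).quasiMeasurePreserving.preimage_ae_eq ?_
  rw [volume_pi]
  exact Measure.univ_pi_Ioo_ae_eq_Icc.trans Measure.univ_pi_Ico_ae_eq_Icc.symm

/-- **Rigid translation**: if `Φ = Φ₀(· - t𝟙)` and `C - t = Q_q` a.e. then
`∫_{cellⁿ} (∫_C |Φ(y, Y)| dy)² dY = ∫_{cellⁿ} (∫_{Q_q} |Φ₀(x, Y)| dx)² dY` (translate `y`, then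
shift the fundamental cell `cellⁿ` using periodicity in every spectator). [folklore] -/
private theorem lintegral_inner_sq_eq (hL : 0 < L) (Φ₀ Φ : PeriodicTrialState (n + 1) L)
    (q : SubIdx 2) {t : Space} (hΦ : Φ.ψ = fun X => Φ₀.ψ (X - fun _ => t)) {C : Set Space}
    (hCt : ((fun x => x + t) ⁻¹' C) =ᵐ[volume] subCell (L / 2) q) :
    ∫⁻ Y in cellN n L, (∫⁻ y in C, (‖Φ.ψ (Matrix.vecCons y Y)‖₊ : ℝ≥0∞)) ^ 2 =
      ∫⁻ Y in cellN n L,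
        (∫⁻ x in subCell (L / 2) q, (‖Φ₀.ψ (Matrix.vecCons x Y)‖₊ : ℝ≥0∞)) ^ 2 := by
  -- adapted from `lintegral_sliceInt_cellShift` of …TorusFloorFromA.lean (no rigid
  -- invariance: the state itself is translated)
  set K : Config n → ℝ≥0∞ := fun Y =>
    ∫⁻ x in subCell (L / 2) q, (‖Φ₀.ψ (Matrix.vecCons x Y)‖₊ : ℝ≥0∞) with hK
  have hJ : ∀ Y : Config n, (∫⁻ y in C, (‖Φ.ψ (Matrix.vecCons y Y)‖₊ : ℝ≥0∞)) =
      K (Y - fun _ => t) := fun Y =>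
    calc (∫⁻ y in C, (‖Φ.ψ (Matrix.vecCons y Y)‖₊ : ℝ≥0∞))
        = ∫⁻ y in C, (‖Φ₀.ψ (Matrix.vecCons (y - t) (Y - fun _ => t))‖₊ : ℝ≥0∞) := by
          simp only [hΦ, vecCons_sub_const]
      _ = ∫⁻ x in (fun x => x + t) ⁻¹' C,
            (‖Φ₀.ψ (Matrix.vecCons x (Y - fun _ => t))‖₊ : ℝ≥0∞) :=
          setLIntegral_comp_sub (fun x => ‖Φ₀.ψ (Matrix.vecCons x (Y - fun _ => t))‖₊) t _
      _ = K (Y - fun _ => t) := setLIntegral_congr hCt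
  have hper : ∀ (Y : Config n) (m : Fin n) (k : Fin 3),
      (fun Y => K Y ^ 2) (Y + Pi.single m (EuclideanSpace.single k L)) =
        (fun Y => K Y ^ 2) Y := by
    intro Y m k
    simp only [hK, cons_add_single_succ, Φ₀.periodic]
  calc ∫⁻ Y in cellN n L, (∫⁻ y in C, (‖Φ.ψ (Matrix.vecCons y Y)‖₊ : ℝ≥0∞)) ^ 2
      = ∫⁻ Y in cellN n L, (fun Y => K Y ^ 2) (Y + -fun _ => t) :=
        lintegral_congr fun Y => by rw [hJ, sub_eq_add_neg]
    _ = ∫⁻ Y in cellN n L, K Y ^ 2 := lintegral_cellN_comp_add hL (G := fun Y => K Y ^ 2) hper _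

/-- **Sub-cube pigeonhole** (no rigid invariance): `n₀(Φ) ≥ c(n+1)` gives a sub-cube `Q_q` of
side `L/2` with `∫_{cellⁿ} (∫_{Q_q} |Φ(x, Y)| dx)² dY ≥ cL³/64`
(`n₀ = (n+1)L⁻³ ∫ |∫_cell Φ|² ≤ (n+1)L⁻³ ∫ (∑_q K_q)² ≤ 8(n+1)L⁻³ ∑_q ∫ K_q²`). [folklore] -/
private theorem exists_subCell_of_condensate (hL : 0 < L) {c : ℝ} (hc : 0 < c)
    (Φ : PeriodicTrialState (n + 1) L)
    (hA : ENNReal.ofReal (c * (n + 1 : ℕ)) ≤ condensateOccupation (n + 1) L Φ.ψ) :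
    ∃ q : SubIdx 2, ENNReal.ofReal (c * L ^ 3 / 64) ≤ ∫⁻ Y in cellN n L,
      (∫⁻ x in subCell (L / 2) q, (‖Φ.ψ (Matrix.vecCons x Y)‖₊ : ℝ≥0∞)) ^ 2 := by
  -- adapted from `condensateOccupation_le_eight_mul` of …TorusFloorFromA.lean
  set K : SubIdx 2 → Config n → ℝ≥0∞ := fun q Y =>
    ∫⁻ x in subCell (L / 2) q, (‖Φ.ψ (Matrix.vecCons x Y)‖₊ : ℝ≥0∞) with hK
  have hΦm : Measurable fun X => (‖Φ.ψ X‖₊ : ℝ≥0∞) :=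
    Φ.contDiff.continuous.measurable.nnnorm.coe_nnreal_ennreal
  have hKm : ∀ q, Measurable (K q) := fun q => measurable_setLIntegral_vecCons hΦm _
  have h8 : (Fintype.card (SubIdx 2) : ℝ≥0∞) = 8 := by
    rw [Fintype.card_fun, Fintype.card_fin, Fintype.card_fin]; norm_num
  have h2L : ((2 : ℕ) : ℝ) * (L / 2) = L := by push_cast; ring
  -- pointwise: `|∫_cell Φ(x,Y) dx|² ≤ (∑_q K_q(Y))² ≤ 8 ∑_q K_q(Y)²`
  have hpt : ∀ Y : Config n, (‖∫ x in cell L, Φ.ψ (Matrix.vecCons x Y)‖₊ : ℝ≥0∞) ^ 2 ≤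
      8 * ∑ q, K q Y ^ 2 := fun Y => by
    have hsum : ∑ q, K q Y = ∫⁻ x in cell L, (‖Φ.ψ (Matrix.vecCons x Y)‖₊ : ℝ≥0∞) := by
      have h := sum_setLIntegral_subCell (k := 2) (half_pos hL)
        (h := fun x => (‖Φ.ψ (Matrix.vecCons x Y)‖₊ : ℝ≥0∞))
        (hΦm.comp (continuous_id.matrixVecCons continuous_const).measurable).aemeasurable
      rwa [h2L] at h
    calc (‖∫ x in cell L, Φ.ψ (Matrix.vecCons x Y)‖₊ : ℝ≥0∞) ^ 2
        ≤ (∫⁻ x in cell L, (‖Φ.ψ (Matrix.vecCons x Y)‖₊ : ℝ≥0∞)) ^ 2 := by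
          gcongr; exact enorm_integral_le_lintegral_enorm _
      _ = (∑ q, K q Y) ^ 2 := by rw [hsum]
      _ ≤ 8 * ∑ q, K q Y ^ 2 := by
          simpa only [Finset.card_univ, h8] using ennreal_sq_sum_le Finset.univ fun q => K q Y
  -- integrate and pigeonhole
  have hI : ∫⁻ Y in cellN n L, (‖∫ x in cell L, Φ.ψ (Matrix.vecCons x Y)‖₊ : ℝ≥0∞) ^ 2 ≤
      8 * ∑ q, ∫⁻ Y in cellN n L, K q Y ^ 2 :=
    calc _ ≤ ∫⁻ Y in cellN n L, 8 * ∑ q, K q Y ^ 2 := lintegral_mono hpt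
      _ = 8 * ∑ q, ∫⁻ Y in cellN n L, K q Y ^ 2 := by
          rw [lintegral_const_mul _ (Finset.measurable_sum _ fun q _ => (hKm q).pow_const 2),
            lintegral_finsetSum _ fun q _ => (hKm q).pow_const 2]
  obtain ⟨q, hq⟩ := exists_sum_le_card_mul fun q => ∫⁻ Y in cellN n L, K q Y ^ 2
  rw [h8] at hq
  refine ⟨q, ?_⟩
  rw [condensateOccupation_succ hL] at hA
  have h1 : ENNReal.ofReal c * (n + 1 : ℝ≥0∞) ≤ (n + 1 : ℝ≥0∞) *
      ((ENNReal.ofReal L ^ 3)⁻¹ * (8 * (8 * ∫⁻ Y in cellN n L, K q Y ^ 2))) :=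
    calc ENNReal.ofReal c * (n + 1 : ℝ≥0∞) = ENNReal.ofReal (c * (n + 1 : ℕ)) := by
          rw [ENNReal.ofReal_mul hc.le, ENNReal.ofReal_natCast, Nat.cast_succ]
      _ ≤ _ := hA
      _ ≤ _ := by gcongr; exact hI.trans (by gcongr)
  rw [mul_comm] at h1
  have h2 := (ENNReal.mul_le_iff_le_inv (pow_ne_zero _ (by simpa using hL))
    (ENNReal.pow_ne_top ENNReal.ofReal_ne_top)).mpr
    ((ENNReal.mul_le_mul_iff_right (Nat.cast_add_one_ne_zero n)
      (by exact_mod_cast ENNReal.natCast_ne_top (n + 1))).mp h1)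
  have h3 : ENNReal.ofReal (c * L ^ 3) ≤ 64 * ∫⁻ Y in cellN n L, K q Y ^ 2 :=
    calc ENNReal.ofReal (c * L ^ 3) = ENNReal.ofReal L ^ 3 * ENNReal.ofReal c := by
          rw [← ENNReal.ofReal_pow hL.le, ← ENNReal.ofReal_mul (by positivity), mul_comm]
      _ ≤ _ := h2
      _ = _ := by rw [← mul_assoc]; norm_num
  rw [ENNReal.ofReal_div_of_pos (by norm_num : (0 : ℝ) < 64), ENNReal.ofReal_ofNat]
  exact ENNReal.div_le_of_le_mul' h3

/-- **One-bath disintegration** (Tonelli in `W = (x, Y)`): for `C ⊆ cell` and `B ≥ 0`,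
`∫_{cellⁿ} (∫_C ρ(x, Y) dx) B(Y) dY ≤ E_P[1_C(w₀) B(Ŵ)]`, `P = ρ 1_{cell^{n+1}} dW`. [folklore] -/
private theorem setLIntegral_mul_le_lintegral_withDensity {ρ : Config (n + 1) → ℝ≥0∞}
    (hρ : Measurable ρ) {C : Set Space} (hC : MeasurableSet C) (hCc : C ⊆ cell L)
    {B : Config n → ℝ≥0∞} (hF : Measurable fun W : Config (n + 1) =>
      C.indicator (fun _ => (1 : ℝ≥0∞)) (W 0) * B (Matrix.vecTail W)) :
    ∫⁻ Y in cellN n L, (∫⁻ x in C, ρ (Matrix.vecCons x Y)) * B Y ≤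
      ∫⁻ W, C.indicator (fun _ => (1 : ℝ≥0∞)) (W 0) * B (Matrix.vecTail W)
        ∂(volume.restrict (cellN (n + 1) L)).withDensity ρ := by
  rw [lintegral_withDensity_eq_lintegral_mul _ hρ hF,
    ← lintegral_indicator (measurableSet_cellN (n + 1) L),
    lintegral_config_succ ((hρ.mul hF).indicator (measurableSet_cellN (n + 1) L)),
    ← lintegral_indicator (measurableSet_cellN n L)]
  refine lintegral_mono fun Y => ?_
  by_cases hY : Y ∈ cellN n L
  · rw [Set.indicator_of_mem hY]
    have hm : Measurable fun x => ρ (Matrix.vecCons x Y) :=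
      hρ.comp (continuous_id.matrixVecCons continuous_const).measurable
    calc (∫⁻ x in C, ρ (Matrix.vecCons x Y)) * B Y = ∫⁻ x in C, ρ (Matrix.vecCons x Y) * B Y :=
          (lintegral_mul_const _ hm).symm
      _ = ∫⁻ x, C.indicator (fun x => ρ (Matrix.vecCons x Y) * B Y) x :=
          (lintegral_indicator hC _).symm
      _ ≤ _ := lintegral_mono fun x => ?_
    by_cases hx : x ∈ C
    · have hxY : Matrix.vecCons x Y ∈ cellN (n + 1) L := fun j =>
        Fin.cases (by simpa using hCc hx) (fun k => by simpa using hY k) j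
      rw [Set.indicator_of_mem hx, Set.indicator_of_mem hxY, Pi.mul_apply, Matrix.cons_val_zero,
        Matrix.tail_cons, Set.indicator_of_mem hx, one_mul]
    · rw [Set.indicator_of_notMem hx]
      exact zero_le
  · rw [Set.indicator_of_notMem hY]
    exact zero_le

end Helpers

/-- **Registered stub `stub_torusTypicality`** (T of line `Sketch`, crux
stmt-AtomisticToContinuum-0827; the skeleton's `TorusTypicality` with `torusLaw`/`TorusGood`
unfolded): an `A`-instance with constant `c` at slack `δ` on the torus of side `L` yields a
`δ`-near-minimiser `Φ` whose law charges the torus-typical event at level `c` with probability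
`≥ c/16`. [folklore] -/
theorem stub_torusTypicality :
    ∀ (v : ℝ → ℝ≥0∞) (n : ℕ) (L : ℝ), 0 < L → ∀ c : ℝ, 0 < c → ∀ δ : ℝ≥0∞, 0 < δ →
    (∀ Φ : PeriodicTrialState (n + 1) L,
      periodicEnergy v Φ ≤ periodicGroundStateEnergy v (n + 1) L + δ →
        ENNReal.ofReal (c * (n + 1 : ℕ)) ≤ condensateOccupation (n + 1) L Φ.ψ) →
    ∃ Φ : PeriodicTrialState (n + 1) L,
      periodicEnergy v Φ ≤ periodicGroundStateEnergy v (n + 1) L + δ ∧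
      ∃ E : Set (Config (n + 1)), MeasurableSet E ∧
        ENNReal.ofReal (c / 16) ≤
          ((volume.restrict (cellN (n + 1) L)).withDensity
            fun W => (‖Φ.ψ W‖₊ : ℝ≥0∞) ^ 2) E ∧
        ∀ W ∈ E,
          W 0 ∈ {x : Space | ∀ t, x t ∈ Set.Ioo (1 / 4 * L) (L - 1 / 4 * L)} ∧
          0 < ∫⁻ y in {x : Space | ∀ t, x t ∈ Set.Ioo (1 / 4 * L) (L - 1 / 4 * L)},
              ENNReal.ofReal ‖Φ.ψ (Matrix.vecCons y (Matrix.vecTail W))‖ ^ 2 ∧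
          ENNReal.ofReal (c / 16) *
              (volume {x : Space | ∀ t, x t ∈ Set.Ioo (1 / 4 * L) (L - 1 / 4 * L)} *
                ∫⁻ y in {x : Space | ∀ t, x t ∈ Set.Ioo (1 / 4 * L) (L - 1 / 4 * L)},
                  ENNReal.ofReal ‖Φ.ψ (Matrix.vecCons y (Matrix.vecTail W))‖ ^ 2) ≤
            (∫⁻ y in {x : Space | ∀ t, x t ∈ Set.Ioo (1 / 4 * L) (L - 1 / 4 * L)},
                ENNReal.ofReal ‖Φ.ψ (Matrix.vecCons y (Matrix.vecTail W))‖) ^ 2 := by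
  intro v n L hL c hc δ hδ hA
  obtain ⟨Φ₀, hΦ₀⟩ := exists_nearMinimiser v (n + 1) hL hδ
  obtain ⟨q, hq⟩ := exists_subCell_of_condensate hL hc Φ₀ (hA Φ₀ hΦ₀)
  obtain ⟨Φ, hΦ⟩ := Φ₀.exists_translate
    (WithLp.toLp 2 fun k => 1 / 4 * L - L / 2 * ((q k : ℕ) : ℝ))
  refine ⟨Φ, (periodicEnergy_translate v Φ₀ _ hΦ).trans_le hΦ₀, ?_⟩
  -- the inner cube `C`, the slices `J`, `M` and the flatness functional `F ≤ 1`
  set C : Set Space := {x : Space | ∀ t, x t ∈ Set.Ioo (1 / 4 * L) (L - 1 / 4 * L)}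
  simp only [ofReal_norm, enorm_eq_nnnorm]
  have hCmeas : MeasurableSet C := TorusInTheBox.measurableSet_innerCube (1 / 4) L
  have hCcell : C ⊆ cell L := fun x hx k => by
    obtain ⟨h1, h2⟩ := hx k
    rw [Set.mem_Ico]
    constructor <;> linarith
  set V : ℝ≥0∞ := volume C
  have hV : V = ENNReal.ofReal ((1 - 2 * (1 / 4)) * L) ^ 3 :=
    TorusInTheBox.volume_innerCube (1 / 4) L
  have hV0 : V ≠ 0 := hV ▸ pow_ne_zero _ (ENNReal.ofReal_pos.mpr (by linarith)).ne'
  have hVt : V ≠ ⊤ := by rw [hV]; exact ENNReal.pow_ne_top ENNReal.ofReal_ne_top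
  have hcont : Continuous Φ.ψ := Φ.contDiff.continuous
  have hρ1 : Measurable fun W => (‖Φ.ψ W‖₊ : ℝ≥0∞) := hcont.measurable.nnnorm.coe_nnreal_ennreal
  set ρ : Config (n + 1) → ℝ≥0∞ := fun W => (‖Φ.ψ W‖₊ : ℝ≥0∞) ^ 2
  have hρm : Measurable ρ := hρ1.pow_const 2
  set J : Config n → ℝ≥0∞ := fun Y =>
    ∫⁻ y in C, (‖Φ.ψ (Matrix.vecCons y Y)‖₊ : ℝ≥0∞)
  set M : Config n → ℝ≥0∞ := fun Y => ∫⁻ y in C, ρ (Matrix.vecCons y Y)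
  have hJm : Measurable J := measurable_setLIntegral_vecCons hρ1 _
  have hMm : Measurable M := measurable_setLIntegral_vecCons hρm _
  have hslice : ∀ Y : Config n, Measurable fun y => (‖Φ.ψ (Matrix.vecCons y Y)‖₊ : ℝ≥0∞) :=
    fun Y => hρ1.comp (continuous_id.matrixVecCons continuous_const).measurable
  have hCS : ∀ Y, J Y ^ 2 ≤ V * M Y := fun Y => sq_setLIntegral_le (hslice Y) _
  have hMt : ∀ Y, M Y ≠ ⊤ := fun Y => by
    refine (lt_of_le_of_lt (lintegral_mono_set hCcell) ?_).ne
    have h : ∫⁻ y in cell L, ‖‖Φ.ψ (Matrix.vecCons y Y)‖ ^ 2‖ₑ < ⊤ :=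
      (integrableOn_sq_cell L (hcont.comp (continuous_id.matrixVecCons continuous_const))).2
    refine lt_of_eq_of_lt (lintegral_congr fun y => ?_) h
    rw [Real.enorm_eq_ofReal (sq_nonneg _), ← coe_nnnorm_sq_eq_ofReal]
  set B : Config n → ℝ≥0∞ := fun Y => J Y ^ 2 / (V * M Y)
  have hBm : Measurable B := (hJm.pow_const 2).div (hMm.const_mul V)
  set F : Config (n + 1) → ℝ≥0∞ := fun W =>
    Set.indicator C (fun _ => (1 : ℝ≥0∞)) (W 0) * B (Matrix.vecTail W)
  have hFm : Measurable F := ((measurable_const.indicator hCmeas).comp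
    (measurable_pi_apply 0)).mul (hBm.comp measurable_vecTail)
  have hF1 : ∀ W, F W ≤ 1 := fun W =>
    mul_le_one' (Set.indicator_apply_le' (fun _ => le_rfl) fun _ => zero_le_one)
      (ENNReal.div_le_of_le_mul' (by rw [mul_one]; exact hCS _))
  set P : Measure (Config (n + 1)) := (volume.restrict (cellN (n + 1) L)).withDensity ρ with hP
  have hP1 : P Set.univ ≤ 1 := by
    rw [hP, withDensity_apply _ MeasurableSet.univ, Measure.restrict_univ]
    exact Φ.norm_eq.le
  -- `E_P[F] ≥ |C|⁻¹ ∫_{cellⁿ} J² ≥ c/8`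
  have hEF : (∫⁻ Y in cellN n L, J Y ^ 2) / V ≤ ∫⁻ W, F W ∂P :=
    calc (∫⁻ Y in cellN n L, J Y ^ 2) / V = ∫⁻ Y in cellN n L, J Y ^ 2 * V⁻¹ := by
          rw [div_eq_mul_inv, lintegral_mul_const _ (hJm.pow_const 2)]
      _ ≤ ∫⁻ Y in cellN n L, M Y * B Y := lintegral_mono fun Y => by
          rw [← div_eq_mul_inv]; exact sq_div_le_mul_div (hMt Y) (hCS Y)
      _ ≤ ∫⁻ W, F W ∂P := setLIntegral_mul_le_lintegral_withDensity hρm hCmeas hCcell hFm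
  set a : ℝ≥0∞ := ENNReal.ofReal (c / 16) with hadef
  have ha0 : a ≠ 0 := (ENNReal.ofReal_pos.mpr (by positivity)).ne'
  have haaV : (a + a) * V = ENNReal.ofReal (c * L ^ 3 / 64) := by
    rw [hadef, hV, ← ENNReal.ofReal_add (by positivity) (by positivity),
      ← ENNReal.ofReal_pow (mul_nonneg (by norm_num) hL.le),
      ← ENNReal.ofReal_mul (by positivity)]
    congr 1; ring
  have hJK : ENNReal.ofReal (c * L ^ 3 / 64) ≤ ∫⁻ Y in cellN n L, J Y ^ 2 :=
    hq.trans_eq (lintegral_inner_sq_eq hL Φ₀ Φ q hΦ (preimage_inner_ae_eq_subCell L q)).symm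
  have hint : a + a ≤ ∫⁻ W, F W ∂P :=
    ((ENNReal.le_div_iff_mul_le (Or.inl hV0) (Or.inl hVt)).mpr (haaV.trans_le hJK)).trans hEF
  -- reverse Markov and the good event
  exact ⟨{W | a ≤ F W}, measurableSet_le measurable_const hFm,
    le_measure_setOf_le hP1 hFm hF1 ENNReal.ofReal_ne_top hint,
    fun W hW => good_of_le ha0 hV0 hVt (hMt _) (hCS _) hW⟩

end Summit.AtomisticToContinuum.BoseEinsteinCondensation.CoupledBaths

end
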